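import Summits.BirchSwinnertonDyer.BirchSwinnertonDyer.Theorems.ManinLocalTwoThreePinningThreeNinetyTwo
import Summits.BirchSwinnertonDyer.BirchSwinnertonDyer.Theorems.ManinLocalTwoThreeRootFormsFiftySix
import Summits.BirchSwinnertonDyer.BirchSwinnertonDyer.Theorems.ManinLocalTwoThreePinningKernelRows
import Summits.BirchSwinnertonDyer.BirchSwinnertonDyer.Theorems.ManinLocalTwoThreeOddTwistRootFormTransport
import Literature.NumberTheory.EllipticCurves.CuspFormTwist
import Literature.NumberTheory.EllipticCurves.RootNumberTwistProofs
import HarnessLib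

/-!
# Level 392 = 2³·7², the classes `56a ⊗ χ₋₇` and `56b ⊗ χ₋₇`: `|c| = 1` UNCONDITIONALLY, by the odd-twist root-form transport at `p = 7`

Cell bsd-f2-manin, route `ManinLocalTwoThree` (crux C2 `ManinOddAtFour`, stmt-BirchSwinnertonDyer-22967; `--supports` helper), LEAD p1 gen 27.
an g58's Fricke-staged kernel pins `S₂(Γ₀(392))` (`…PinningThreeNinetyTwo`, kernel part I, landed by this seat): six certificates `rowA…rowF` (the
two sign-runs `certP ++ certM`, `a₃ ∈ {−3, −1, 0, −2, 1, 3}`).  The kernel census (`p1 g27 scripts/census2.py`, `n < 128`) finds exactly two twists of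
complete roots: `a₃ = 0` is `56a ⊗ χ₋₇` and `a₃ = −2` is `56b ⊗ χ₋₇` (`χ₋₇ = (·/7)`, the primitive quadratic character mod `7`); the other four are
twist-minimal.  Template LEAD g26 `…ManinConstantTwoHundredC`:
* §1 rows: twisted tables `tabTC/tabTD` to depth `128` (`≥ 118` = dual support), row identities (kernel `decide`), an g55's row lemma in `V = S₂(Γ₀(392))`
  (`dim = 41`, `d = 224`): `f_cases`, `f_eq_charTwist_phiFiftySixA_of_lFunction_three` (`a₃ = 0`), `f_eq_charTwist_phiFiftySixB_of_lFunction_three` (`a₃ = −2`);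
* §2 headlines by p3's engine `OddTwistRootForm.abs_maninConstant_eq_one_of_rootForm_charTwist_eq` (`p = 7`, `M = 56 ∣ 392`, `7² ∣ 392`) with this seat's
  root packages `RootFormsFiftySix.exists_neron_squeeze_phiFiftySixA/B` + multiplicativity at `7`:
  **`abs_maninConstant_eq_one_threeNinetyTwo_of_lFunction_three_eq_zero`**, **`…_of_lFunction_three_eq_neg_two`**, `2 ∤ c`, `7 ∤ c` there.
HONEST FRAMING: unconditional (standard axioms); TWO of the six classes of level 392; no root datum, no modularity input, no CDT, no printed Manin fact;
nothing here proves C2/C3, Manin's conjecture or BSD. [cite: CremonaAlgorithms1997, §2.10, Table 1 (N = 56, 392)] [cite: Shimura1971, Prop. 3.64]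
[cite: Stevens1989, Lemma (5.2) p. 96, Lemma (5.4) p. 97] [cite: AgasheRibetStein2006, §§1–2]
-/

set_option autoImplicit false
-- lint-debt: the directory name repeats the summit name (sibling precedent `ManinLocalTwoThreeManinConstantTwoHundredC.lean`)
set_option linter.dupNamespace false

noncomputable section

open Complex
open UpperHalfPlane hiding I
open scoped MatrixGroups ModularForm
open ModularForm CongruenceSubgroup PowerSeries
open Literature.NumberTheory.ModularForms
open Literature.NumberTheory.EllipticCurves Literature.NumberTheory.EllipticCurves.ModularForms

namespace Summit.BirchSwinnertonDyer.BirchSwinnertonDyer.Theorems.ManinLocalTwoThree.LevelThreeNinetyTwo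

open Summit.BirchSwinnertonDyer.BirchSwinnertonDyer.Theorems.ManinLocalTwoThree
open Summit.BirchSwinnertonDyer.BirchSwinnertonDyer.Theorems
open BracketSturm PinningKernel PinningThreeNinetyTwo OddTwistRootForm RootFormsFiftySix ManinConstantFiftySix

set_option maxHeartbeats 4000000
set_option maxRecDepth 16384

variable {W : WeierstrassCurve ℚ} [W.IsElliptic]

/-! ## §1 The rows -/

/-- The certificate `392a`-row of an's two sign-runs (`a₃ = -3`). [folklore] -/
def rowA : List (ℕ × ℤ) × ℤ × List ℤ :=
  ([(2, 0), (7, 0), (3, -3), (5, 1), (11, -1), (13, -2), (17, -3)], 1, [0, 0, 0, -1, 0, 2, 0, -1, -4, 0, -3, 0, -4, -4, 0, -4, 0, 4, 0, 0, 0, -3, 7, -14, 0, 3, 0, 0, 0, 3, 7, 0, 0, 0, 4, 0, 0, 0, 28, 0, 28])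

/-- The certificate `392b`-row of an's two sign-runs (`a₃ = -1`). [folklore] -/
def rowB : List (ℕ × ℤ) × ℤ × List ℤ :=
  ([(2, 0), (7, 0), (3, -1), (5, -1), (11, 3), (13, -6), (17, -5)], 1, [0, 0, 0, 1, 0, 0, 0, 1, 4, 0, -3, 0, 4, 0, 0, 0, 0, 0, 0, 0, 0, 3, -7, 0, 0, 3, 0, 0, 0, -3, -7, 0, 0, 0, 0, 0, 0, 0, -28, 0, -28])

/-- The certificate `392c`-row of an's two sign-runs (`a₃ = 0`) — the class `56a ⊗ χ₋₇`. [folklore] -/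
def rowC : List (ℕ × ℤ) × ℤ × List ℤ :=
  ([(2, 0), (7, 0), (3, 0), (5, -2), (11, -4), (13, -2), (17, 6)], 1, [0, 0, 0, -1, 0, 2, 0, -1, -4, 0, 0, 0, -4, -4, 0, -4, 0, 4, 0, 0, 0, 0, 7, -14, 0, 0, 0, 0, 0, 0, 7, 0, 0, 0, 4, 0, 0, 0, 28, 0, 28])

/-- The certificate `392d`-row of an's two sign-runs (`a₃ = -2`) — the class `56b ⊗ χ₋₇`. [folklore] -/
def rowD : List (ℕ × ℤ) × ℤ × List ℤ :=
  ([(2, 0), (7, 0), (3, -2), (5, 4), (11, 0), (13, 0), (17, 2)], 1, [0, 0, 0, 1, 0, 0, 0, 1, 4, -4, 0, 0, 4, 8, -4, 8, -16, 8, -4, 0, 0, 0, 7, 0, 0, 0, 0, -4, -16, 0, 7, 0, 0, 0, 8, -16, -16, 0, 28, 0, 28])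

/-- The certificate `392e`-row of an's two sign-runs (`a₃ = 1`). [folklore] -/
def rowE : List (ℕ × ℤ) × ℤ × List ℤ :=
  ([(2, 0), (7, 0), (3, 1), (5, 1), (11, 3), (13, 6), (17, 5)], 1, [0, 0, 0, 1, 0, 0, 0, 1, 4, -4, 3, 0, 4, 8, -4, 8, -16, 8, -4, 0, 0, 3, 7, 0, 0, 3, 0, -4, -16, 3, 7, 0, 0, 0, 8, -16, -16, 0, 28, 0, 28])

/-- The certificate `392f`-row of an's two sign-runs (`a₃ = 3`). [folklore] -/
def rowF : List (ℕ × ℤ) × ℤ × List ℤ :=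
  ([(2, 0), (7, 0), (3, 3), (5, -1), (11, -1), (13, 2), (17, 3)], 1, [0, 0, 0, -1, 0, 2, 0, -1, -4, 0, 3, 0, -4, 0, 0, 0, 0, 0, 0, 0, 0, -3, -7, 14, 0, 3, 0, 0, 0, -3, -7, 0, 0, 0, 0, 0, 0, 0, -28, 0, -28])

/-- `certP ++ certM` is literally the list of the six rows. [folklore] -/
theorem certs_eq_rows : certP ++ certM = [rowA, rowB, rowC, rowD, rowE, rowF] := rfl

/-- `(n/7)·aₙ(φ₅₆ₐ)` to depth `128` — the row `392c` (`56a ⊗ χ₋₇`). [cite: CremonaAlgorithms1997, Table 1 (N = 392)] -/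
def tabTC : List ℤ :=
  [0, 1, 0, 0, 0, -2, 0, 0, 0, -3, 0, -4, 0, -2, 0, 0, 0, 6, 0, -8, 0, 0, 0, 0, 0, -1, 0, 0, 0, 6, 0, -8, 0, 0, 0, 0, 0, -2, 0, 0, 0, -2, 0, -4, 0,
  6, 0, 8, 0, 0, 0, 0, 0, 6, 0, 8, 0, 0, 0, 0, 0, 6, 0, 0, 0, 4, 0, -4, 0, 0, 0, -8, 0, -10, 0, 0, 0, 0, 0, 16, 0, 9, 0, -8, 0, -12, 0, 0, 0, 6, 0,
  0, 0, 0, 0, 16, 0, 6, 0, 12, 0, -2, 0, 16, 0, 0, 0, -12, 0, -10, 0, 0, 0, 2, 0, 0, 0, 6, 0, 0, 0, 5, 0, 0, 0, 12, 0, -8]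

/-- `(n/7)·aₙ(φ₅₆ᵦ)` to depth `128` — the row `392d` (`56b ⊗ χ₋₇`). [cite: CremonaAlgorithms1997, Table 1 (N = 392)] -/
def tabTD : List ℤ :=
  [0, 1, 0, -2, 0, 4, 0, 0, 0, 1, 0, 0, 0, 0, 0, -8, 0, 2, 0, 2, 0, 0, 0, 8, 0, 11, 0, 4, 0, 2, 0, -4, 0, 0, 0, 0, 0, -6, 0, 0, 0, 2, 0, 8, 0, 4, 0,
  4, 0, 0, 0, -4, 0, -10, 0, 0, 0, -4, 0, -6, 0, -4, 0, 0, 0, 0, 0, -12, 0, -16, 0, 0, 0, 14, 0, -22, 0, 0, 0, -8, 0, -11, 0, -6, 0, 8, 0, -4, 0,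
  -10, 0, 0, 0, 8, 0, 8, 0, 2, 0, 0, 0, -12, 0, 12, 0, 0, 0, -12, 0, 10, 0, 12, 0, 6, 0, 32, 0, 0, 0, 0, 0, -11, 0, -4, 0, 24, 0, 8]

/-- `tabTC[n] = (n/7)·t56a[n]`, `n < 128`. [folklore] -/
theorem hTwC : ∀ n < 128, tabTC.getD n 0 = legendreSym 7 n * t56a.getD n 0 := by
  decide +kernel

/-- `tabTD[n] = (n/7)·t56b[n]`, `n < 128`. [folklore] -/
theorem hTwD : ∀ n < 128, tabTD.getD n 0 = legendreSym 7 n * t56b.getD n 0 := by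
  decide +kernel

/-- **Row identity `392c`.** [folklore] -/
theorem hrowC : ∀ n < 128, rowC.2.1 * tabTC.getD n 0 = ∑ j : Fin 41, rowC.2.2.getD (j : ℕ) 0 * (tabs j).getD n 0 := by
  decide +kernel

/-- **Row identity `392d`.** [folklore] -/
theorem hrowD : ∀ n < 128, rowD.2.1 * tabTD.getD n 0 = ∑ j : Fin 41, rowD.2.2.getD (j : ℕ) 0 * (tabs j).getD n 0 := by
  decide +kernel

/-- `aₙ(φ₅₆ₐ ⊗ χ₋₇) = tabTC[n]`, `n < 128`. [cite: Shimura1971, Prop. 3.64] -/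
theorem tabTC_eq_cuspCoeff [Fact (Nat.Prime 7)] : ∀ n < 128, ((tabTC.getD n 0 : ℤ) : ℂ) =
    cuspCoeffₗ (one_mem_strictPeriods_coe_gamma0 392) n (charTwist 392 (⟨7, rfl⟩ : 56 ∣ 392) (⟨8, rfl⟩ : 7 ^ 2 ∣ 392) (isQuadratic_quadraticChar_ringHomComp 7) phiFiftySixA) := by
  intro n hn
  have hc : ((tabTC.getD n 0 : ℤ) : ℂ) = ((legendreSym 7 n : ℤ) : ℂ) * ((t56a.getD n 0 : ℤ) : ℂ) := by exact_mod_cast hTwC n hn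
  rw [cuspCoeffₗ_apply, cuspCoeff_charTwist 392 _ _ (isQuadratic_quadraticChar_ringHomComp 7)
    (isPrimitive_quadraticChar_ringHomComp 7 (by norm_num)), quadraticChar_ringHomComp_apply_natCast, ← t56a_eq_cuspCoeff n hn]
  exact hc

/-- `aₙ(φ₅₆ᵦ ⊗ χ₋₇) = tabTD[n]`, `n < 128`. [cite: Shimura1971, Prop. 3.64] -/
theorem tabTD_eq_cuspCoeff [Fact (Nat.Prime 7)] : ∀ n < 128, ((tabTD.getD n 0 : ℤ) : ℂ) =
    cuspCoeffₗ (one_mem_strictPeriods_coe_gamma0 392) n (charTwist 392 (⟨7, rfl⟩ : 56 ∣ 392) (⟨8, rfl⟩ : 7 ^ 2 ∣ 392) (isQuadratic_quadraticChar_ringHomComp 7) phiFiftySixB) := by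
  intro n hn
  have hc : ((tabTD.getD n 0 : ℤ) : ℂ) = ((legendreSym 7 n : ℤ) : ℂ) * ((t56b.getD n 0 : ℤ) : ℂ) := by exact_mod_cast hTwD n hn
  rw [cuspCoeffₗ_apply, cuspCoeff_charTwist 392 _ _ (isQuadratic_quadraticChar_ringHomComp 7)
    (isPrimitive_quadraticChar_ringHomComp 7 (by norm_num)), quadraticChar_ringHomComp_apply_natCast, ← t56b_eq_cuspCoeff n hn]
  exact hc

/-- **LEVEL 392: THE ROWS.**  For every `X₀(392)`-datum `D` of an elliptic `W/ℚ`: the sieve truth row is one of the six certificates; on the third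
(`a₃ = 0`) `D.f = φ₅₆ₐ ⊗ χ₋₇`, on the fourth (`a₃ = −2`) `D.f = φ₅₆ᵦ ⊗ χ₋₇`. [cite: CremonaAlgorithms1997, §2.10, Table 1 (N = 392)] [cite: Shimura1971, Prop. 3.64] -/
theorem f_cases [Fact (Nat.Prime 7)] (D : ModularParametrizationData W 392) :
    truth W [2, 7, 3, 5, 11, 13, 17] = rowA.1 ∨
    truth W [2, 7, 3, 5, 11, 13, 17] = rowB.1 ∨
    (truth W [2, 7, 3, 5, 11, 13, 17] = rowC.1 ∧
      D.f = charTwist 392 (⟨7, rfl⟩ : 56 ∣ 392) (⟨8, rfl⟩ : 7 ^ 2 ∣ 392) (isQuadratic_quadraticChar_ringHomComp 7) phiFiftySixA) ∨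
    (truth W [2, 7, 3, 5, 11, 13, 17] = rowD.1 ∧
      D.f = charTwist 392 (⟨7, rfl⟩ : 56 ∣ 392) (⟨8, rfl⟩ : 7 ^ 2 ∣ 392) (isQuadratic_quadraticChar_ringHomComp 7) phiFiftySixB) ∨
    truth W [2, 7, 3, 5, 11, 13, 17] = rowE.1 ∨
    truth W [2, 7, 3, 5, 11, 13, 17] = rowF.1 := by
  haveI : FiniteDimensional ℂ (CuspForm (Gamma0 392) 2) := finiteDimensional_cuspForm_gamma0 392 2
  have hlen : ∀ i : Fin 41, (duals i).length ≤ 128 := by decide +kernel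
  obtain ⟨S, C, hCS, hC, c, hc, htruth, hpinS, -⟩ := pinning_cusp D
  have ht := tables_of_etaCertsSparse 392 128 (fun i : Fin 41 ↦ expFn (Ls[(i : ℕ)]).1) (fun i ↦ shifts i) tabs C hC hshift hcert
  have htS : ∀ i, ∀ n < 128, (((tabs i).getD n 0 : ℤ) : ℂ) = cuspCoeffₗ (one_mem_strictPeriods_coe_gamma0 392) n (S i) :=
    fun i n hn ↦ by rw [cuspCoeffₗ_apply, ← modCoefₗ_modularForm (S i) n, hCS]; exact ht i n hn
  rw [certs_eq_rows] at hc
  simp only [List.mem_cons, List.mem_nil_iff, or_false] at hc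
  rcases hc with rfl | rfl | rfl | rfl | rfl | rfl
  · exact Or.inl htruth
  · exact Or.inr (Or.inl htruth)
  · exact Or.inr (Or.inr (Or.inl ⟨htruth, eq_of_smul_eq_sum_of_row S tabs duals 224 htS hlen hdual (by norm_num) finrank_cuspForm_two _
      tabTC tabTC_eq_cuspCoeff rowC.2.1 (by decide) rowC.2.2 hpinS hrowC⟩))
  · exact Or.inr (Or.inr (Or.inr (Or.inl ⟨htruth, eq_of_smul_eq_sum_of_row S tabs duals 224 htS hlen hdual (by norm_num) finrank_cuspForm_two _
      tabTD tabTD_eq_cuspCoeff rowD.2.1 (by decide) rowD.2.2 hpinS hrowD⟩)))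
  · exact Or.inr (Or.inr (Or.inr (Or.inr (Or.inl htruth))))
  · exact Or.inr (Or.inr (Or.inr (Or.inr (Or.inr (htruth)))))

omit [W.IsElliptic] in
/-- The `a₃` entry of the truth row. [folklore] -/
theorem key (row : List (ℕ × ℤ) × ℤ × List ℤ) (h : truth W [2, 7, 3, 5, 11, 13, 17] = row.1) : W.LFunction 3 = (row.1.getD 2 (0, 0)).2 := by
  simpa [truth] using congrArg (fun l : List (ℕ × ℤ) ↦ (l.getD 2 (0, 0)).2) h

/-- **The row selected by `a₃(W) = 0`**: `D.f = φ₅₆ₐ ⊗ χ₋₇`. [cite: CremonaAlgorithms1997, Table 1 (N = 392)] -/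
theorem f_eq_charTwist_phiFiftySixA_of_lFunction_three [Fact (Nat.Prime 7)] (D : ModularParametrizationData W 392) (h3 : W.LFunction 3 = 0) :
    D.f = charTwist 392 (⟨7, rfl⟩ : 56 ∣ 392) (⟨8, rfl⟩ : 7 ^ 2 ∣ 392) (isQuadratic_quadraticChar_ringHomComp 7) phiFiftySixA := by
  rcases f_cases D with h | h | ⟨h, hf⟩ | ⟨h, hf⟩ | h | h
  · have h' := key rowA h; rw [h3] at h'; simp [rowA] at h'
  · have h' := key rowB h; rw [h3] at h'; simp [rowB] at h'
  · exact hf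
  · have h' := key rowD h; rw [h3] at h'; simp [rowD] at h'
  · have h' := key rowE h; rw [h3] at h'; simp [rowE] at h'
  · have h' := key rowF h; rw [h3] at h'; simp [rowF] at h'

/-- **The row selected by `a₃(W) = −2`**: `D.f = φ₅₆ᵦ ⊗ χ₋₇`. [cite: CremonaAlgorithms1997, Table 1 (N = 392)] -/
theorem f_eq_charTwist_phiFiftySixB_of_lFunction_three [Fact (Nat.Prime 7)] (D : ModularParametrizationData W 392) (h3 : W.LFunction 3 = -2) :
    D.f = charTwist 392 (⟨7, rfl⟩ : 56 ∣ 392) (⟨8, rfl⟩ : 7 ^ 2 ∣ 392) (isQuadratic_quadraticChar_ringHomComp 7) phiFiftySixB := by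
  rcases f_cases D with h | h | ⟨h, hf⟩ | ⟨h, hf⟩ | h | h
  · have h' := key rowA h; rw [h3] at h'; simp [rowA] at h'
  · have h' := key rowB h; rw [h3] at h'; simp [rowB] at h'
  · have h' := key rowC h; rw [h3] at h'; simp [rowC] at h'
  · exact hf
  · have h' := key rowE h; rw [h3] at h'; simp [rowE] at h'
  · have h' := key rowF h; rw [h3] at h'; simp [rowF] at h'

/-! ## §2 The headlines -/

/-- **`|c| = 1` ON THE CLASS `56a ⊗ χ₋₇` OF LEVEL 392, UNCONDITIONALLY** (`a₃(W) = 0`): row `D.f = φ₅₆ₐ ⊗ χ₋₇`, root squeeze `Λ(φ₅₆ₐ) ⊆ Λ_Néron(56a1)`,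
`56a1` multiplicative at `7`, p3's odd-twist ROOT-FORM transport at `p = 7`. [cite: Stevens1989, Lemma (5.2) p. 96, Lemma (5.4) p. 97]
[cite: AgasheRibetStein2006, §§1–2] [cite: CremonaAlgorithms1997, Table 1 (56a1), Table 1 (N = 392)] -/
theorem abs_maninConstant_eq_one_threeNinetyTwo_of_lFunction_three_eq_zero (W : WeierstrassCurve ℚ) [W.IsElliptic] [W.IsGloballyMinimal]
    (D : ModularParametrizationData W 392) (h3 : W.LFunction 3 = 0) (hopt : ∀ z ∈ D.L.lattice, ∃ w ∈ periodLattice D.f, z = D.c * w) :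
    |D.maninConstant| = 1 := by
  haveI h7 : Fact (Nat.Prime 7) := ⟨by norm_num⟩
  obtain ⟨L₀, hL₀, hle⟩ := exists_neron_squeeze_phiFiftySixA
  haveI := isElliptic_fiftySixA1
  haveI := isGloballyMinimal_fiftySixA1
  exact abs_maninConstant_eq_one_of_rootForm_charTwist_eq (p := 7) (by norm_num) (isQuadratic_quadraticChar_ringHomComp 7)
    (isPrimitive_quadraticChar_ringHomComp 7 (by norm_num)) phiFiftySixA (⟨0, 0, 0, 1, 2⟩ : WeierstrassCurve ℚ) L₀ hL₀ hle
    (Or.inr hasMultiplicativeReductionAtPrime_seven_fiftySixA1) W D _ _ (f_eq_charTwist_phiFiftySixA_of_lFunction_three D h3) hopt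

/-- **`|c| = 1` ON THE CLASS `56b ⊗ χ₋₇` OF LEVEL 392, UNCONDITIONALLY** (`a₃(W) = −2`). [cite: Stevens1989, Lemma (5.2) p. 96, Lemma (5.4) p. 97]
[cite: AgasheRibetStein2006, §§1–2] [cite: CremonaAlgorithms1997, Table 1 (56b1), Table 1 (N = 392)] -/
theorem abs_maninConstant_eq_one_threeNinetyTwo_of_lFunction_three_eq_neg_two (W : WeierstrassCurve ℚ) [W.IsElliptic] [W.IsGloballyMinimal]
    (D : ModularParametrizationData W 392) (h3 : W.LFunction 3 = -2) (hopt : ∀ z ∈ D.L.lattice, ∃ w ∈ periodLattice D.f, z = D.c * w) :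
    |D.maninConstant| = 1 := by
  haveI h7 : Fact (Nat.Prime 7) := ⟨by norm_num⟩
  obtain ⟨L₀, hL₀, hle⟩ := exists_neron_squeeze_phiFiftySixB
  haveI := isElliptic_fiftySixB1
  haveI := isGloballyMinimal_fiftySixB1
  exact abs_maninConstant_eq_one_of_rootForm_charTwist_eq (p := 7) (by norm_num) (isQuadratic_quadraticChar_ringHomComp 7)
    (isPrimitive_quadraticChar_ringHomComp 7 (by norm_num)) phiFiftySixB (⟨0, -1, 0, 0, -4⟩ : WeierstrassCurve ℚ) L₀ hL₀ hle
    (Or.inr hasMultiplicativeReductionAtPrime_seven_fiftySixB1) W D _ _ (f_eq_charTwist_phiFiftySixB_of_lFunction_three D h3) hopt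

/-- **`|c| = 1` on the two transported classes of level 392** (`a₃ ∈ {0, −2}`). [cite: AgasheRibetStein2006, §§1–2] -/
theorem abs_maninConstant_eq_one_threeNinetyTwo_of_rowCD (W : WeierstrassCurve ℚ) [W.IsElliptic] [W.IsGloballyMinimal]
    (D : ModularParametrizationData W 392) (h : W.LFunction 3 = 0 ∨ W.LFunction 3 = -2)
    (hopt : ∀ z ∈ D.L.lattice, ∃ w ∈ periodLattice D.f, z = D.c * w) : |D.maninConstant| = 1 := by
  rcases h with h3 | h3
  · exact abs_maninConstant_eq_one_threeNinetyTwo_of_lFunction_three_eq_zero W D h3 hopt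
  · exact abs_maninConstant_eq_one_threeNinetyTwo_of_lFunction_three_eq_neg_two W D h3 hopt

/-- **No integer `q` with `|q| ≠ 1` — in particular neither `2` nor `7` — divides `c` there.** [folklore] -/
theorem not_dvd_maninConstant_threeNinetyTwo_of_rowCD (W : WeierstrassCurve ℚ) [W.IsElliptic] [W.IsGloballyMinimal]
    (D : ModularParametrizationData W 392) (h : W.LFunction 3 = 0 ∨ W.LFunction 3 = -2)
    (hopt : ∀ z ∈ D.L.lattice, ∃ w ∈ periodLattice D.f, z = D.c * w) {q : ℤ} (hq : q.natAbs ≠ 1) : ¬ q ∣ D.maninConstant := by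
  intro hd
  have h1 := abs_maninConstant_eq_one_threeNinetyTwo_of_rowCD W D h hopt
  have hn : D.maninConstant.natAbs = 1 := by
    rw [Int.abs_eq_natAbs] at h1
    exact_mod_cast h1
  have h2 : q.natAbs ∣ 1 := hn ▸ Int.natAbs_dvd_natAbs.mpr hd
  exact hq (Nat.dvd_one.mp h2)

/-- **`2 ∤ c` on the two transported classes of level `392`** — the body of C2 `ManinOddAtFour` at `N = 392` there. [cite: AgasheRibetStein2006, §§1–2] -/
theorem not_two_dvd_maninConstant_threeNinetyTwo_of_rowCD (W : WeierstrassCurve ℚ) [W.IsElliptic] [W.IsGloballyMinimal]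
    (D : ModularParametrizationData W 392) (h : W.LFunction 3 = 0 ∨ W.LFunction 3 = -2)
    (hopt : ∀ z ∈ D.L.lattice, ∃ w ∈ periodLattice D.f, z = D.c * w) : ¬ (2 : ℤ) ∣ D.maninConstant :=
  not_dvd_maninConstant_threeNinetyTwo_of_rowCD W D h hopt (by decide)

/-- **`7 ∤ c` there** (the residual conjunct's body at `p = 7`, `7² ∣ 392`, on these classes). [cite: AgasheRibetStein2006, §§1–2] -/
theorem not_seven_dvd_maninConstant_threeNinetyTwo_of_rowCD (W : WeierstrassCurve ℚ) [W.IsElliptic] [W.IsGloballyMinimal]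
    (D : ModularParametrizationData W 392) (h : W.LFunction 3 = 0 ∨ W.LFunction 3 = -2)
    (hopt : ∀ z ∈ D.L.lattice, ∃ w ∈ periodLattice D.f, z = D.c * w) : ¬ (7 : ℤ) ∣ D.maninConstant :=
  not_dvd_maninConstant_threeNinetyTwo_of_rowCD W D h hopt (by decide)

end Summit.BirchSwinnertonDyer.BirchSwinnertonDyer.Theorems.ManinLocalTwoThree.LevelThreeNinetyTwo

end
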